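import Mathlib
import HarnessLib
import Literature.Computability.AlgebraicComplexity.KabanetsImpagliazzoHardness
import Literature.Computability.AlgebraicComplexity.KRSTDesign
import Literature.Computability.AlgebraicComplexity.DDS21UABPWeaklySkew
import Summits.ValiantsHypothesis.ValiantsHypothesis.Theorems.DefinabilityGapAffineRung
import Summits.ValiantsHypothesis.ValiantsHypothesis.Theorems.DefinabilityGapKIHybridWs
import Summits.ValiantsHypothesis.ValiantsHypothesis.Theorems.DefinabilityGapROABPWs

/-!
# DefinabilityGap — KI reconstruction in `VBP` currency from `VBP` factor closure
# (support for `KIPlantedHitting`, item `stmt-ValiantsHypothesis-23547`)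

Support for route `route-ValiantsHypothesis-DefinabilityGap` (decomp-valiant lens 5, gen 2; critic wish w2). The lens's typed
print hypothesis `KIReconstructionWs` —

  `∃ a, ∀ m D, D ≠ 0 → D ∘ G_m = 0 → L_ws(per_m) ≤ (L_ws(D) + q(m))^a`

(`G_m = kiPer m`, the KI-planted permanent map) — is here DERIVED (kernel) from ONE clean literature input, factor closure of
`VBP` in `L_ws` currency (Sinhababu–Thierauf 2020, Thm 1: the factors of a polynomial with an ABP of size `s` have ABPs of
size `poly(s)`), stated as the explicit hypothesis

  `hfac : ∃ a, ∀ σ (P Q : MvPolynomial σ ℂ), P ≠ 0 → Q ∣ P → L_ws(Q) ≤ (L_ws(P) + #σ + 2)^a`.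

Chain (all kernel): hybrid argument in `VBP` currency (`DefinabilityGapKIHybridWs`) for `kiPer m = KI-gen(perPad, quadDesign)`
⟹ nonzero `H(x, c)` with `H(x, perPad(x)) = 0` and `L_ws(H) ≤ poly(L_ws D, m, q)`; Gauss (`X_sub_rename_dvd_of_root`):
`(c - perPad) ∣ H`; factor closure: `L_ws(perPad - c) ≤ (L_ws H + q + 3)^a`; substitution `c ↦ 0` and un-padding
(`VBP` closed under composition) recover `perPad`, then `per_m`; a two-variable polynomial-domination calculus (`PolyDom`)
packages the composite bound as `(L_ws D + q)^A` for a universal `A`.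
-/

noncomputable section

open MvPolynomial
open Literature.Computability.AlgebraicComplexity Literature.Computability.MetaComplexity
open Summit.ValiantsHypothesis.ValiantsHypothesis.Theorems.DefinabilityGapAffineRung
  (qOf qOf_spec sq_le_qOf quadDesign kiPer quadDesign_isNWDesign)
open Summit.ValiantsHypothesis.ValiantsHypothesis.Theorems.DefinabilityGapROABPWs (wsOfInvRepr invReprOfComp)
open Summit.ValiantsHypothesis.ValiantsHypothesis.Theorems.DefinabilityGapKIHybridWs
  (exists_ws_root_of_kiGenerator_annihilated)

namespace Summit.ValiantsHypothesis.ValiantsHypothesis.Theorems.DefinabilityGapKIReconstructionWs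

/-! ## Monotonicity of the explicit bounds -/

/-- `wsOfInvRepr` is monotone. [this route: DefinabilityGap, lens-5 split kit] -/
theorem wsOfInvRepr_mono {m m' n n' : ℕ} (hm : m ≤ m') (hn : n ≤ n') :
    wsOfInvRepr m n ≤ wsOfInvRepr m' n' := by
  unfold wsOfInvRepr
  gcongr

/-- `invReprOfComp` is monotone. [this route: DefinabilityGap, lens-5 split kit] -/
theorem invReprOfComp_mono {r r' b b' : ℕ} (hr : r ≤ r') (hb : b ≤ b') :
    invReprOfComp r b ≤ invReprOfComp r' b' := by
  unfold invReprOfComp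
  gcongr

/-! ## A two-variable polynomial-domination calculus -/

/-- `t(s, q) ≤ (s + q)^c` for all `s` and all `q ≥ 2`, for some constant `c`. [folklore] -/
def PolyDom (t : ℕ → ℕ → ℕ) : Prop :=
  ∃ c : ℕ, ∀ s q : ℕ, 2 ≤ q → t s q ≤ (s + q) ^ c

namespace PolyDom

variable {t u : ℕ → ℕ → ℕ}

/-- Constants are dominated. [folklore] -/
theorem const (k : ℕ) : PolyDom fun _ _ => k :=
  ⟨k, fun s q hq => (Nat.lt_two_pow_self).le.trans (Nat.pow_le_pow_left (by omega) k)⟩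

/-- The first variable is dominated. [folklore] -/
theorem fst : PolyDom fun s _ => s :=
  ⟨1, fun s q _ => show s ≤ (s + q) ^ 1 by rw [pow_one]; exact Nat.le_add_right s q⟩

/-- The second variable is dominated. [folklore] -/
theorem snd : PolyDom fun _ q => q :=
  ⟨1, fun s q _ => show q ≤ (s + q) ^ 1 by rw [pow_one]; exact Nat.le_add_left q s⟩

/-- Sums. [folklore] -/
theorem add (ht : PolyDom t) (hu : PolyDom u) : PolyDom fun s q => t s q + u s q := by
  obtain ⟨a, ha⟩ := ht
  obtain ⟨b, hb⟩ := hu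
  refine ⟨max a b + 1, fun s q hq => ?_⟩
  have hY : 2 ≤ s + q := by omega
  have h1 : (s + q) ^ a ≤ (s + q) ^ max a b := Nat.pow_le_pow_right (by omega) (le_max_left _ _)
  have h2 : (s + q) ^ b ≤ (s + q) ^ max a b := Nat.pow_le_pow_right (by omega) (le_max_right _ _)
  calc t s q + u s q ≤ (s + q) ^ max a b + (s + q) ^ max a b := Nat.add_le_add ((ha s q hq).trans h1) ((hb s q hq).trans h2)
    _ = (s + q) ^ max a b * 2 := by ring
    _ ≤ (s + q) ^ max a b * (s + q) := Nat.mul_le_mul_left _ hY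
    _ = (s + q) ^ (max a b + 1) := by rw [pow_succ]

/-- Products. [folklore] -/
theorem mul (ht : PolyDom t) (hu : PolyDom u) : PolyDom fun s q => t s q * u s q := by
  obtain ⟨a, ha⟩ := ht
  obtain ⟨b, hb⟩ := hu
  refine ⟨a + b, fun s q hq => ?_⟩
  rw [pow_add]
  exact Nat.mul_le_mul (ha s q hq) (hb s q hq)

/-- Fixed powers. [folklore] -/
theorem pow (ht : PolyDom t) (k : ℕ) : PolyDom fun s q => t s q ^ k := by
  obtain ⟨a, ha⟩ := ht
  refine ⟨a * k, fun s q hq => ?_⟩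
  rw [pow_mul]
  exact Nat.pow_le_pow_left (ha s q hq) k

end PolyDom

/-- `wsOfInvRepr` of dominated arguments is dominated. [this route: DefinabilityGap, lens-5 split kit] -/
theorem polyDom_wsOfInvRepr {M N : ℕ → ℕ → ℕ} (hM : PolyDom M) (hN : PolyDom N) :
    PolyDom fun s q => wsOfInvRepr (M s q) (N s q) := by
  have h1 : PolyDom fun s q => M s q + 1 := PolyDom.add hM (PolyDom.const 1)
  unfold wsOfInvRepr
  exact PolyDom.mul
    (PolyDom.add
      (PolyDom.mul (PolyDom.add h1 (PolyDom.const 2))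
        (PolyDom.pow
          (PolyDom.add (PolyDom.mul (PolyDom.const 4) (PolyDom.pow h1 3)) (PolyDom.const 7)) 2))
      (PolyDom.mul h1 h1))
    (PolyDom.add (PolyDom.mul (PolyDom.const 2) hN) (PolyDom.const 3))

/-- `invReprOfComp` of dominated arguments is dominated. [this route: DefinabilityGap, lens-5 split kit] -/
theorem polyDom_invReprOfComp {R R' : ℕ → ℕ → ℕ} (hR : PolyDom R) (hR' : PolyDom R') :
    PolyDom fun s q => invReprOfComp (R s q) (R' s q) := by
  have hX : PolyDom fun s q => 12 * R s q + 4 :=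
    PolyDom.add (PolyDom.mul (PolyDom.const 12) hR) (PolyDom.const 4)
  have hY : PolyDom fun s q => 24 * R s q + 4 :=
    PolyDom.add (PolyDom.mul (PolyDom.const 24) hR) (PolyDom.const 4)
  have hX' : PolyDom fun s q => 12 * R' s q + 4 :=
    PolyDom.add (PolyDom.mul (PolyDom.const 12) hR') (PolyDom.const 4)
  have hY' : PolyDom fun s q => 24 * R' s q + 4 :=
    PolyDom.add (PolyDom.mul (PolyDom.const 24) hR') (PolyDom.const 4)
  have hXY : PolyDom fun s q => (12 * R s q + 4) * (24 * R s q + 4) := PolyDom.mul hX hY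
  unfold invReprOfComp
  exact PolyDom.add
    (PolyDom.add
      (PolyDom.mul (PolyDom.mul hXY hXY)
        (PolyDom.add (PolyDom.add (PolyDom.mul hX' hY') (PolyDom.const 2)) (PolyDom.const 6)))
      hXY)
    (PolyDom.const 2)

/-! ## The chain -/

/-- The four explicit bounds of the chain, with `m` already replaced by `q` (monotonicity), as a function of
`s = L_ws(D)` and `q`; `a` is the factor-closure exponent. [this route: DefinabilityGap, lens-5 split kit] -/
def chainBound (a s q : ℕ) : ℕ :=
  let e1 := wsOfInvRepr (invReprOfComp s ((q + 1) ^ 2 * (2 * q + 2))) (q + 1)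
  let e2 := (e1 + (q + 1) + 2) ^ a
  let e3 := wsOfInvRepr (invReprOfComp e2 0) q
  wsOfInvRepr (invReprOfComp e3 0) q

/-- The chain bound is polynomially dominated in `(s, q)`. [this route: DefinabilityGap, lens-5 split kit] -/
theorem polyDom_chainBound (a : ℕ) : PolyDom fun s q => chainBound a s q := by
  have hq1 : PolyDom fun _ q => q + 1 := PolyDom.add PolyDom.snd (PolyDom.const 1)
  have he1 : PolyDom fun s q => wsOfInvRepr (invReprOfComp s ((q + 1) ^ 2 * (2 * q + 2))) (q + 1) :=
    polyDom_wsOfInvRepr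
      (polyDom_invReprOfComp PolyDom.fst
        (PolyDom.mul (PolyDom.pow hq1 2)
          (PolyDom.add (PolyDom.mul (PolyDom.const 2) PolyDom.snd) (PolyDom.const 2))))
      hq1
  have he2 : PolyDom fun s q =>
      (wsOfInvRepr (invReprOfComp s ((q + 1) ^ 2 * (2 * q + 2))) (q + 1) + (q + 1) + 2) ^ a :=
    PolyDom.pow (PolyDom.add (PolyDom.add he1 hq1) (PolyDom.const 2)) a
  have he3 := polyDom_wsOfInvRepr (polyDom_invReprOfComp he2 (PolyDom.const 0)) PolyDom.snd
  have he4 := polyDom_wsOfInvRepr (polyDom_invReprOfComp he3 (PolyDom.const 0)) PolyDom.snd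
  unfold chainBound
  exact he4

/-- `L_ws(X i) ≤ 0` and `L_ws(C c) ≤ 0` packaged for substitutions by variables-or-zero.
[cite: BurgisserEtAl2011, §9.1 (L_e ≥ L_ws)] -/
theorem wsComplexity_X_or_zero_le {σ : Type*} (g : MvPolynomial σ ℂ)
    (hg : g = 0 ∨ ∃ i, g = X i) : wsComplexity g ≤ 0 := by
  refine (wsComplexity_le_formulaComplexity g).trans ?_
  rcases hg with rfl | ⟨i, rfl⟩
  · rw [← C_0]; exact UABPWs.formulaComplexity_C_le _
  · exact UABPWs.formulaComplexity_X_le _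

/-- **Step 1 (hybrid, kernel)**: a nonzero annihilator `D` of `G_m = kiPer m` yields a nonzero `H(x, c)` over
`Option (Fin q(m))` with `H(x, perPad(x)) = 0` and `L_ws(H) ≤ wsOfInvRepr (invReprOfComp (L_ws D) ((m+1)²(2m+2))) (q+1)`.
[cite: KabanetsImpagliazzo2003, Lemma 30 (proof, I)] -/
theorem exists_ws_root_of_kiPer_annihilated (m : ℕ) {D : MvPolynomial (Fin 3 → Fin (qOf m)) ℂ}
    (hD : D ≠ 0) (hann : bind₁ (kiPer m) D = 0) :
    ∃ H : MvPolynomial (Option (Fin (qOf m))) ℂ, H ≠ 0 ∧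
      bind₁ (fun o => o.elim (perPad ℂ (sq_le_qOf m)) X) H = 0 ∧
      wsComplexity H ≤ wsOfInvRepr (invReprOfComp (wsComplexity D) ((m + 1) ^ 2 * (2 * m + 2))) (qOf m + 1) := by
  obtain ⟨H, hH, hroot, hws, -⟩ :=
    exists_ws_root_of_kiGenerator_annihilated (quadDesign_isNWDesign m) (perPad ℂ (sq_le_qOf m)) hD hann
  refine ⟨H, hH, hroot, hws.trans (wsOfInvRepr_mono (invReprOfComp_mono le_rfl ?_) (by simp))⟩
  have hdeg := totalDegree_perPad_le (F := ℂ) (sq_le_qOf m)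
  gcongr

/-- **Steps 2–4 (kernel)**: from such an `H` and factor closure of `VBP`, `per_m` has small weakly-skew circuits:
`L_ws(per_m) ≤ wsOfInvRepr (invReprOfComp E3 0) (m·m)` with `E3 = wsOfInvRepr (invReprOfComp ((L_ws H + q + 3)^a) 0) q`
(Gauss: `(c - perPad) ∣ H`; factor closure; `c ↦ 0`; un-padding). [cite: KabanetsImpagliazzo2003, Lemma 28, Lemma 30 (proof, II)] -/
theorem wsComplexity_perPoly_le_of_root {m a : ℕ}
    (hfac : ∀ (σ : Type) [Fintype σ] [DecidableEq σ] (P Q : MvPolynomial σ ℂ), P ≠ 0 → Q ∣ P →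
      wsComplexity Q ≤ (wsComplexity P + Fintype.card σ + 2) ^ a)
    {H : MvPolynomial (Option (Fin (qOf m))) ℂ} (hH : H ≠ 0)
    (hroot : bind₁ (fun o => o.elim (perPad ℂ (sq_le_qOf m)) X) H = 0) :
    wsComplexity (perPoly (Fin m) ℂ) ≤
      wsOfInvRepr (invReprOfComp
        (wsOfInvRepr (invReprOfComp ((wsComplexity H + (qOf m + 1) + 2) ^ a) 0) (qOf m)) 0) (m * m) := by
  classical
  set f : MvPolynomial (Fin (qOf m)) ℂ := perPad ℂ (sq_le_qOf m) with hf
  -- Step 2: Gauss + factor closure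
  set Q : MvPolynomial (Option (Fin (qOf m))) ℂ := rename some f - X none with hQ
  have hdvd : Q ∣ H := by
    have h := X_sub_rename_dvd_of_root f hroot
    rw [hQ, ← neg_sub]
    exact (neg_dvd).2 h
  have hwsQ : wsComplexity Q ≤ (wsComplexity H + (qOf m + 1) + 2) ^ a := by
    have := hfac (Option (Fin (qOf m))) H Q hH hdvd
    simpa [Fintype.card_option] using this
  -- Step 3: `c ↦ 0` recovers `perPad`
  set κ : Option (Fin (qOf m)) → MvPolynomial (Fin (qOf m)) ℂ := fun o => o.elim 0 X with hκ
  have hκQ : aeval κ Q = f := by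
    rw [aeval_eq_bind₁, hQ, map_sub, bind₁_rename, bind₁_X_right]
    have hcomp : (κ ∘ some) = X := funext fun b => by simp [hκ]
    rw [hcomp]
    have : bind₁ (X : Fin (qOf m) → MvPolynomial (Fin (qOf m)) ℂ) f = f :=
      (AlgHom.congr_fun bind₁_X_left f).trans (AlgHom.id_apply f)
    rw [this]
    simp [hκ]
  have hκws : ∀ o, wsComplexity (κ o) ≤ 0 := by
    rintro (_ | b)
    · exact wsComplexity_X_or_zero_le _ (Or.inl rfl)
    · exact wsComplexity_X_or_zero_le _ (Or.inr ⟨b, rfl⟩)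
  have hwsf : wsComplexity f ≤
      wsOfInvRepr (invReprOfComp ((wsComplexity H + (qOf m + 1) + 2) ^ a) 0) (qOf m) := by
    have hrepr := hasInvRepr_aeval_of_wsComplexity_le hwsQ κ hκws
    rw [hκQ] at hrepr
    refine (wsComplexity_le_of_hasInvRepr hrepr).trans (le_of_eq ?_)
    simp only [wsOfInvRepr, invReprOfComp, Fintype.card_fin]
  -- Step 4: un-padding recovers `per_m`
  set κ' : Fin (qOf m) → MvPolynomial (Fin m × Fin m) ℂ :=
    fun j => if h : ∃ ij, permPad (sq_le_qOf m) ij = j then X h.choose else 0 with hκ'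
  have hκ'f : aeval κ' f = perPoly (Fin m) ℂ := by
    rw [hf, perPad, aeval_rename]
    have hcomp : (κ' ∘ permPad (sq_le_qOf m)) = X := by
      funext ij
      have h : ∃ ij', permPad (sq_le_qOf m) ij' = permPad (sq_le_qOf m) ij := ⟨ij, rfl⟩
      have hc : h.choose = ij := (permPad (sq_le_qOf m)).injective h.choose_spec
      simp only [Function.comp_apply, hκ', dif_pos h, hc]
    rw [hcomp, aeval_X_left, AlgHom.id_apply]
  have hκ'ws : ∀ j, wsComplexity (κ' j) ≤ 0 := by
    intro j
    by_cases h : ∃ ij, permPad (sq_le_qOf m) ij = j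
    · refine wsComplexity_X_or_zero_le _ (Or.inr ⟨h.choose, ?_⟩)
      simp only [hκ', dif_pos h]
    · refine wsComplexity_X_or_zero_le _ (Or.inl ?_)
      simp only [hκ', dif_neg h]
  have hrepr := hasInvRepr_aeval_of_wsComplexity_le hwsf κ' hκ'ws
  rw [hκ'f] at hrepr
  refine (wsComplexity_le_of_hasInvRepr hrepr).trans (le_of_eq ?_)
  simp only [wsOfInvRepr, invReprOfComp, Fintype.card_prod, Fintype.card_fin]

/-- **KI reconstruction in `VBP` currency for the KI-planted permanent map, from `VBP` factor closure (kernel).**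
With the factor-closure input (Sinhababu–Thierauf 2020, Thm 1, in `L_ws` currency) as hypothesis, a nonzero annihilator
`D` of `G_m` with small weakly-skew complexity forces small weakly-skew complexity of `per_m`, polynomially and uniformly:
`∃ A, ∀ m D, D ≠ 0 → D ∘ G_m = 0 → L_ws(per_m) ≤ (L_ws(D) + q(m))^A`. This is literally the lens-5 node's
`VBPFactorClosure → KIReconstructionWs`. [cite: KabanetsImpagliazzo2003, Lemma 30; Burgisser2024Completeness, §3.1] -/
theorem kiReconstructionWs_of_factorClosure
    (hfac : ∃ a : ℕ, ∀ (σ : Type) [Fintype σ] [DecidableEq σ] (P Q : MvPolynomial σ ℂ), P ≠ 0 → Q ∣ P →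
      wsComplexity Q ≤ (wsComplexity P + Fintype.card σ + 2) ^ a) :
    ∃ A : ℕ, ∀ (m : ℕ) (D : MvPolynomial (Fin 3 → Fin (qOf m)) ℂ), D ≠ 0 → bind₁ (kiPer m) D = 0 →
      wsComplexity (perPoly (Fin m) ℂ) ≤ (wsComplexity D + qOf m) ^ A := by
  obtain ⟨a, hfac⟩ := hfac
  obtain ⟨A, hA⟩ := polyDom_chainBound a
  refine ⟨A, fun m D hD hann => ?_⟩
  have hq2 : 2 ≤ qOf m := (qOf_spec m).2.two_le
  have hmq : m ≤ qOf m := by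
    have := sq_le_qOf m
    rcases Nat.eq_zero_or_pos m with h0 | hpos
    · omega
    · calc m = m * 1 := (mul_one m).symm
        _ ≤ m * m := Nat.mul_le_mul_left m hpos
        _ ≤ qOf m := this
  obtain ⟨H, hH, hroot, hwsH⟩ := exists_ws_root_of_kiPer_annihilated m hD hann
  have hper := wsComplexity_perPoly_le_of_root (a := a) hfac hH hroot
  refine hper.trans (le_trans ?_ (hA (wsComplexity D) (qOf m) hq2))
  unfold chainBound
  dsimp only
  refine wsOfInvRepr_mono (invReprOfComp_mono (wsOfInvRepr_mono (invReprOfComp_mono ?_ le_rfl) le_rfl) le_rfl)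
    (sq_le_qOf m)
  gcongr (?_ + _ + _) ^ _
  refine hwsH.trans (wsOfInvRepr_mono (invReprOfComp_mono le_rfl ?_) le_rfl)
  gcongr

end Summit.ValiantsHypothesis.ValiantsHypothesis.Theorems.DefinabilityGapKIReconstructionWs

end
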